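import HarnessLib
import Summits.QuantumFields.YangMills.Theses.BalabanLadder
import Summits.QuantumFields.YangMills.Theorems.BalabanLadderUVSeamRecStubTransport
import Summits.QuantumFields.YangMills.Theorems.BalabanLadderUVSeamRecUnitTransfer
import Summits.QuantumFields.YangMills.Theorems.BalabanLadderUVSeamRecCeilingsResponseMomentsUnit
import Literature.MathematicalPhysics.QuantumLattice.RepLieAlgebraUnitary
import Summits.QuantumFields.YangMills.Theorems.BalabanLadderUVSeamRecCeilingsGuardedPeelingDefs
import Summits.QuantumFields.YangMills.Theorems.BalabanLadderUVSeamRecCeilingsDLRPeelingSemiclassical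

/-! # LINE «guarded-classical-gap» for crux `UVSeamRec` (stmt-QuantumFields-20043) — ideator ym-idea-10 (lens RESCUER), line 2, 2026-08-28

A RESCUED skeleton (not a registry write; the owner's pen decides).  CORPSE: v8d(β-cl-GUCR) (lane B gen 9, `UVSeamRec_v8d_gucr_candidate.lean`
a1723ecd80e8bdad; glue p593010 `responseMomentsOdd6SU2_of_splitCl_gaussianDomination_guardedConditionalRarity`, package
`DLRPeeling.BackgroundFieldGUCRSU2`).  Its located weak point (LANE-B-g9 §5, STATE-OF-THE-CRUX-g10): the `∀η` one-box rarity of the GUARDED event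
«child block `e`-large, b-adic parent NOT `ρe`-large» is free of exterior-driven floors ONLY IF no (near-)minimiser of a Dirichlet problem realises a
guarded event — «a heuristic, recorded as such in every docstring» (K5); at level 1 with `b = 3` lattice dislocations are marginal.  Second weak point:
the ONE ∃-package `BackgroundFieldGUCRSU2` lets nobody attack the classical geometry and the quantum expansion separately, and its thresholds have a
floor but no CEILING, so the package says nothing about where the small-field radius of the expansion must sit.

THE DODGE, as explicit stubs — cut the package along the classical ∕ quantum seam with a two-constant interface {small-field radius `ε_t`, gap `δ`}:
* `stub_classicalGapData` (CLASSICAL, zero temperature; K5 typed): for EVERY target radius `ε_t > 0` there are admissible tempering ∕ guard data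
  (block size, threshold schedule with floor `ε₀`, eventually `≤ ε_t`, schedule `ε(k+s) ≤ ρ ε(k)`, termination `2 < ρ^J ε₀`, collar `m ≥ 3`) and a gap
  constant `δ > 0` such that, uniformly in the level `k ≥ 1`, the threshold `e ≥ ε β k`, the block, the orientation and the EXTERIOR `η`, every interior
  configuration of the parent's collar cube realising the guarded event costs at least `δ·e` of boundary Wilson action above some other interior
  configuration (`ClassicalGap`; scale-free because block field and action scale alike).  This is exactly the consistency the guard was invented for,
  now a crux with an instrument (cooling with prescribed coherent ∕ topological exteriors: does any ground state realise a guarded event above the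
  schedule?).  It is essentially NECESSARY for (GUCR): a minimiser inside a guarded event gives `kerE^η_β(1_G) ↛ 0` (Laplace lower bound), so this stub
  is also v8d's kill path, typed.
* `stub_temperedPackageGivenGap` (QUANTUM ∕ RG; v8d's package made CONDITIONAL and ∀-quantified over the data): there is a small-field radius `ε_t > 0`
  such that for ANY admissible data whose thresholds are eventually `≤ ε_t` and whose guarded events have a uniform classical gap, the tempered split
  (split-cl), the guarded rarity (GUCR) with weights `w ≥ 0` and the plain budget `Σ_{1≤k≤kmax} w ≤ D` hold (Bałaban's theorem-shape: the small-field
  condition is at the supplier's disposal; the rarity half is Laplace ∕ R-operation ABOVE A GIVEN CLASSICAL GAP instead of above a heuristic).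
* `stub_gaussianDomination : GaussianDominationSU2`, `stub_floorsEngine` — as in every (β) variant (the latter BYTE-IDENTICAL to v5(α); NT desk).
TRUTH-IN-LABELLING (K1): no `UV →` prefix on the measure-side stubs (idle as plumbed, LEAD g5/g10 §5(3)(a)); `UVSeamRec_of` still concludes `UV → …`.
K2 (constant reference) cannot bite: `SplitCl`'s reference `p` is ∃-quantified and β-dependent (pinned by the thermal floor, not refuted); the cold-wall
unbundling of line «coldwall-pure» applies verbatim if wanted.  K4 (flat-penetration floor): removed by the guard (v8d's own dodge), whose consistency is
now `stub_classicalGapData` instead of prose.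

GLUE (kernel-checked here): `backgroundFieldGUCRSU2_of_stubs` (a common block size `2·max b₀ b₁ + 3`; radius from the quantum stub, data from the classical
stub, package repacked in the letters of `DLRPeeling.BackgroundFieldGUCRSU2`), then v8d's landed glue BY NAME.  REV 2 (03:3xZ, after idea-crit-9 VERDICT #2
PASS-WITH-PRICE): the data class is BOUNDED (`s ≥ 1`, `ρ ≤ b^{4s}`, `ε_t ≤ 2ε₀`) and the block size is chosen by the quantum side from a threshold on, so the
∀-weight of the quantum stub is what a Bałaban-reader can size (PRICE (1) answered); nothing hand-fixed (4c(iv)).  Stubs (sorries) = {`stub_classicalGapData`,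
`stub_temperedPackageGivenGap`, `stub_gaussianDomination`, `stub_floorsEngine`}; THEOREMS: `backgroundFieldGUCRSU2_of_stubs`, `stub_responseMomentsOdd6`
((RM) text of v5(α) verbatim), `stub_ceilings`, `stub_transport`, `UVSeamRec_of`.  Relation to line 1 «coldwall-pure»: with thresholds frozen above 2
the guarded events are empty and this line would collapse to the flag-free split — the clause «eventually `≤ ε_t` for EVERY `ε_t`» is what forbids that
collapse and makes the flags usable by the expansion; so this is the Bałaban-compatible twin of line 1 (never expand a kernel whose shell carries an
unexcused large field), at the price of the rarity half, with the price's consistency typed.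
HONEST FRAMING: a re-cut of OPEN conditional content plus kernel-checked glue; nothing of E0′, NT or a gap is claimed; not Clay.
-/

namespace Summit.QuantumFields.YangMills.Cruxes.UVSeamRec.GuardedClassicalGap

open Literature.MathematicalPhysics.QuantumFieldTheory
open Summit.QuantumFields.YangMills.Cruxes.OSLegsFromFemtoAndGap.DlrCollarTransfer
open Filter Topology Finset
open scoped SchwartzMap
open Literature.MathematicalPhysics.QuantumLattice (thetaTest LGConfig fundamentalLatticeRep wilsonBoundaryAction)
open Literature.Probability.LatticeModels (glueWith)
open Summit.QuantumFields.YangMills.Cruxes.UVSeamRec.PolymerData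
open Summit.QuantumFields.YangMills.Cruxes.UVSeamRec.ClassicalResponse (SplitCl GaussianDominationSU2)
open Summit.QuantumFields.YangMills.Cruxes.UVSeamRec.DLRPeeling
  (GuardedConditionalRaritySU2 BackgroundFieldGUCRSU2 responseMomentsOdd6SU2_of_backgroundFieldGUCR_and_gaussianDomination)

/-- The FUNDAMENTAL (defining) lattice representation of `SU(2)` (as v4-F/v5(α)). -/
abbrev rF : LatticeRep (Matrix.specialUnitaryGroup (Fin 2) ℂ) :=
  Literature.MathematicalPhysics.QuantumLattice.fundamentalLatticeRep 2

/-- the unit of record (abbreviation used only inside this skeleton). -/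
noncomputable abbrev uRec : ℝ → ℝ := fun β => Real.exp (Summit.QuantumFields.YangMills.Theorems.FemtoTransferGap.sizeLog β 1)

/-- The interior links of the COLLAR CUBE of the b-adic `s`-parent of the level-`k` block `z`: corner `b^{k+s}(z/b^s − m)`, side `(2m+1)b^{k+s}`
(the cube of `DLRPeeling.GuardedConditionalRaritySU2`, same letters). -/
noncomputable abbrev collarCube (𝔟 : BlockSize) (m s k : ℕ) (z : Fin 4 → ℤ) :
    Finset (Literature.MathematicalPhysics.QuantumLattice.ZdEdge 4) :=
  cubeEdges (fun c => (𝔟.b : ℤ) ^ (k + s) * (z c / (𝔟.b : ℤ) ^ s - m)) ((2 * m + 1) * 𝔟.b ^ (k + s))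

/-- **(CG) «CLASSICAL GAP of one guarded event»** (zero temperature, `SU(2)` fundamental): in the parent's collar cube with EXTERIOR `η`, every interior
configuration `ζ` whose glued configuration `ζ ∨ η` realises the guarded event «block `(k, z, μν)` is `e`-large and its `s`-parent is NOT `ρe`-large»
costs at least `δ·e` of boundary Wilson action more than some other interior configuration `ζ'` (equivalently: more than the minimum, which is attained
on the compact fibre).  The letters are those of the fixed-level rung `DLRPeeling.uniformConditionalRarity_of_classicalNoPenetration` (p576821), whose
qualitative hypothesis «no minimiser in the event» this quantifies. -/
def ClassicalGap (𝔟 : BlockSize) (m s : ℕ) (ρ δ : ℝ) (k : ℕ) (e : ℝ) (z : Fin 4 → ℤ) (μ ν : Fin 4) (h : μ < ν)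
    (η : LGConfig 4 (Matrix.specialUnitaryGroup (Fin 2) ℂ)) : Prop :=
  ∀ ζ : ↥(collarCube 𝔟 m s k z) → Matrix.specialUnitaryGroup (Fin 2) ℂ,
    glueWith (collarCube 𝔟 m s k z) ζ η ∈
        (largeFieldEvent (N := 2) 𝔟 e ⟨k, z, μ, ν, h⟩ \
          largeFieldEvent (N := 2) 𝔟 (ρ * e) ⟨k + s, fun c => z c / (𝔟.b : ℤ) ^ s, μ, ν, h⟩) →
      ∃ ζ' : ↥(collarCube 𝔟 m s k z) → Matrix.specialUnitaryGroup (Fin 2) ℂ,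
        wilsonBoundaryAction rF.ρ (collarCube 𝔟 m s k z) (glueWith (collarCube 𝔟 m s k z) ζ' η) + δ * e ≤
          wilsonBoundaryAction rF.ρ (collarCube 𝔟 m s k z) (glueWith (collarCube 𝔟 m s k z) ζ η)

/-- **(CG-unif) the classical gap UNIFORMLY** in the level `k ≥ 1`, the threshold `e ≥ ε β k`, the block, the orientation and the exterior. -/
def ClassicalGapUniform (𝔟 : BlockSize) (ε : ℝ → ℕ → ℝ) (m s : ℕ) (ρ δ : ℝ) : Prop :=
  ∀ (β : ℝ) (k : ℕ), 1 ≤ k → ∀ e : ℝ, ε β k ≤ e → ∀ (z : Fin 4 → ℤ) (μ ν : Fin 4) (h : μ < ν)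
    (η : LGConfig 4 (Matrix.specialUnitaryGroup (Fin 2) ℂ)), ClassicalGap 𝔟 m s ρ δ k e z μ ν h η

/-- ADMISSIBLE (BOUNDED) tempering ∕ guard data at block size `𝔟` with target small-field radius `ε_t` (rev 2, answering idea-crit-9 VERDICT #2
PRICE (1) «bound the data class»): the clauses consumed by v8d's glue in the letters of `BackgroundFieldGUCRSU2` — uniform threshold floor `0 < ε₀ ≤ ε β k`,
`1 ≤ J`, `0 ≤ ρ`, termination `2 < ρ^J ε₀`, schedule `ε β (k+s) ≤ ρ·ε β k`, collar `3 ≤ m` — PLUS the bounds that make the class sizeable by a reader of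
[Bałaban CMP 122]: guard depth `1 ≤ s`; guard ratio below the coherent parent:child ratio, `ρ ≤ b^{4s}` (beyond it the guard is vacuous for coherent fields);
the floor TIED to the radius, `ε_t ≤ 2ε₀` (so at levels `k ≥ k₀` the thresholds sit in `[ε_t/2, ε_t]`, level-independent up to a factor 2, as in Bałaban's
small-field conditions); and the ceiling `ε β k ≤ ε_t` for `k ≥ k₀` (low levels `k < k₀` may carry larger thresholds — the lattice-dislocation dodge). -/
def Admissible (ε_t : ℝ) (𝔟 : BlockSize) (ε : ℝ → ℕ → ℝ) (m s J k₀ : ℕ) (ρ ε₀ : ℝ) : Prop :=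
  0 < ε₀ ∧ (∀ β k, ε₀ ≤ ε β k) ∧ 1 ≤ J ∧ 0 ≤ ρ ∧ 2 < ρ ^ J * ε₀ ∧ (∀ β k, ε β (k + s) ≤ ρ * ε β k) ∧ 3 ≤ m ∧
    1 ≤ s ∧ ρ ≤ (𝔟.b : ℝ) ^ (4 * s) ∧ ε_t ≤ 2 * ε₀ ∧ ∀ β k, k₀ ≤ k → ε β k ≤ ε_t

/-- D0 (iso-transport) — PROVED (`Transport.stub_transport_proved`, p412513); text = v5(α) verbatim. -/
theorem stub_transport :
    (letI : MeasurableSpace (Matrix.specialUnitaryGroup (Fin 2) ℂ) := borel _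
     haveI : BorelSpace (Matrix.specialUnitaryGroup (Fin 2) ℂ) := ⟨rfl⟩
     ∃ r₂ : LatticeRep (Matrix.specialUnitaryGroup (Fin 2) ℂ),
       LowerBounds (Matrix.specialUnitaryGroup (Fin 2) ℂ) r₂ uRec ∧ MomentBounds6 (Matrix.specialUnitaryGroup (Fin 2) ℂ) r₂ uRec) →
    ∀ (G : Type) [Group G] [TopologicalSpace G] [IsTopologicalGroup G] [CompactSpace G],
      IsCompactSimpleLieGroup G → Nonempty (G ≃ₜ* Matrix.specialUnitaryGroup (Fin 2) ℂ) →
      letI : MeasurableSpace G := borel G; haveI : BorelSpace G := ⟨rfl⟩;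
      ∃ r : LatticeRep G, LowerBounds G r uRec ∧ MomentBounds6 G r uRec := by
  exact Summit.QuantumFields.YangMills.Cruxes.UVSeamRec.Transport.stub_transport_proved

/-- STUB (CG-data) «ADMISSIBLE GUARD DATA WITH A UNIFORM CLASSICAL GAP, for every large block size and every target radius» (L∕XL; CLASSICAL — zero
temperature, one Dirichlet cube at a time; NAMES DEATH K5).  From some block size `b₀` on (larger blocks are classically easier: coherent ratio `b^{4s}`,
dislocations `C_b b^{−4k}`), for every odd `b ≥ b₀` and every `ε_t > 0`: a threshold schedule (floor `ε₀`, eventually `≤ ε_t`, `ε(k+s) ≤ ρε(k)`,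
`2 < ρ^J ε₀`), a collar `m ≥ 3`, a guard depth `s`, a ratio `ρ` and a gap `δ > 0` with `ClassicalGapUniform`.  Why plausible: (a) COHERENT
(boundary-driven) excitation raises parent and child block fields in the ratio `≈ b^{4s}` (Cauchy–Schwarz tight for uniform flux; LEAD g7 cooling kit:
penetration `d⁻⁴`-consistent), so with `ρ < u₀ b^{4s}` a coherently excited child has an excited parent — outside the guarded event; (b) LOCALISED lumps
of size `≪ b^{k+s}` inside a minimiser are excluded at levels `k ≥ k₁` by interior regularity of discrete Yang–Mills minimisers (ε-regularity ∕
monotonicity: small normalised energy on the parent block ⇒ curvature bounds on the child block), and lattice-scale dislocations (instanton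
fall-through, forced by topological boundary data) contribute `≤ C_b b^{−4k}` to the level-`k` block field — below a schedule that starts at
`ε β 1 ≥ C_b b^{−4}` and decreases geometrically to the floor (allowed: only `ε(k+s) ≤ ρε(k)` and the floor are consumed downstream); (c) the GAP is
linear in `e` and scale-free because `blockField ≤ C_b × (Wilson action inside the block)` (Cauchy–Schwarz on the averaged holonomy; the line's FIRST
LEMMA, M-sized) while the action of the glued minimiser is what it is — coercivity of the convex small-field region does the rest.  Why it might FAIL:
a family of exteriors whose Dirichlet minimisers carry a localised NON-lattice-scale concentration deep inside the cube with small parent field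
(degenerate moduli of near-instantons at scale `b^k`, `1 ≪ b^k ≪` cube: the lattice breaks scale invariance only by `O(a²/ρ_inst²)`, so near-minimisers
with a lump of scale `b^k` cost only `O(b^{−2k})` above the fall-through — the gap `δ·e` must come from the event's threshold `e ≥ ε₀`, not from the lump's
size); level `k = 1`, `b = 3` marginal (lane B).  INSTRUMENT (kit_allowed elsewhere): LEAD g7 coherent-flux COOLING kit re-aimed — gradient flow ∕
relaxation of the collar cube with prescribed exteriors (coherent flux, centre-vortex twist, unit topological charge, rough layers): record min action
and min action restricted to the guarded event (constrained cooling), levels `k = 1, 2`, `b = 3`, `m = 3`, `s = 1`, `ρ = 15`; a ground state inside a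
guarded event above the schedule KILLS the data point, a measured gap `∝ e` calibrates `δ`.  Either outcome fixes the admissible low-level schedule. -/
theorem stub_classicalGapData :
    ∃ b₀ : ℕ, ∀ 𝔟 : BlockSize, b₀ ≤ 𝔟.b → ∀ ε_t : ℝ, 0 < ε_t →
      ∃ (ε : ℝ → ℕ → ℝ) (m s J k₀ : ℕ) (ρ ε₀ δ : ℝ),
        Admissible ε_t 𝔟 ε m s J k₀ ρ ε₀ ∧ 0 < δ ∧ ClassicalGapUniform 𝔟 ε m s ρ δ := by
  sorry

/-- STUB (TP|CG) «THE TEMPERED PACKAGE ABOVE A GIVEN CLASSICAL GAP» (XL; QUANTUM ∕ RG; HARDEST; v8d's `BackgroundFieldGUCRSU2` made conditional on the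
classical gap and universally quantified over the BOUNDED data class, minus the idle `UV →`; rev 2: the block size is the RG side's to choose — from some
`b₁` on, as Bałaban's contraction estimates want — and the radius may depend on it).  From some block size `b₁` on, for every odd `b ≥ b₁` there is a
small-field radius `ε_t > 0` such that for ANY schedule, collar, guard data that are `Admissible ε_t 𝔟` (bounded class: `s ≥ 1`, `ρ ≤ b^{4s}`, `ε_t ≤ 2ε₀`,
thresholds eventually `≤ ε_t`) and ANY gap constant `δ > 0` with `ClassicalGapUniform`: tempering top levels `kmax`, constants
`C_s C₁ A₀ P₀ β₁ ℓ₁ D`, β-dependent bounded references `p` and weights `w ≥ 0` with (split-cl) `SplitCl 𝔟 ε kmax C_s C₁ A₀ β₁ ℓ₁ p` («quantum response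
≤ A₀ + β × classical response + influence of the flagged shell polymers», window `R·uRec β ≤ ℓ₁`), the guarded one-box rarity
`GuardedConditionalRaritySU2 𝔟 ε β₁ m s ρ w` for EVERY exterior, and the plain budget `Σ_{1≤k≤kmax β R} w β k ≤ D`.  Why plausible: this is the shape of
[Bałaban, CMP 122 (1989)] small/large-field analysis in ONE Dirichlet box — the small-field condition (`ε_t`) is the supplier's to choose, unflagged
shells are small-field backgrounds for the expansion of the cube kernel (split), and a flagged-but-guarded event sits `β·δ·e ≥ β·δ·ε₀` deep in the
Boltzmann weight by HYPOTHESIS, so the rarity weights are Laplace bounds `w β k ≲ K e^{−cβδε₀}` whose k-UNIFORM prefactor `K` is the R-operation content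
(the fixed-level version with k-dependent constants is the tree's `uniformConditionalRarity_of_classicalNoPenetration` + `guardedConditionalRaritySU2_of_
uniformConditionalRarity`); the budget over `k ≤ kmax ≲ log_b R ≤ β/(4b₀ ln b)` is then `≤ sup_β (β/(4b₀ ln b)) K e^{−cβδε₀} < ∞`.  Gaussian calibration of
(split-cl): seam-s2 (quantum response = classical response for the lattice GFF).  Why it might FAIL: (i) k-uniformity of the Laplace prefactor at the
intermediate levels `¼ log_b β ≲ k ≲ log_b R` is a renormalisation-group theorem nobody has in print at observable level for YM₄ (E0′-K with background;
barrier UVStabilityNonUniqueness in the form «uniformity in R ≤ ℓ₁/uRec β»); (ii) the split's remainder must be `O(R⁻⁴)` uniformly for unflagged shells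
with fields up to the LOW-level thresholds `C_b b^{−4k}` (lattice-scale roughness treated as small field); (iii) reference `p` pinned to the perturbative
plaquette mean by the thermal floor (`6/(24β+3)`, p592470) — consistent, but any proof must produce it. -/
theorem stub_temperedPackageGivenGap :
    ∃ b₁ : ℕ, ∀ 𝔟 : BlockSize, b₁ ≤ 𝔟.b → ∃ ε_t : ℝ, 0 < ε_t ∧
      ∀ (ε : ℝ → ℕ → ℝ) (m s J k₀ : ℕ) (ρ ε₀ δ : ℝ),
        Admissible ε_t 𝔟 ε m s J k₀ ρ ε₀ → 0 < δ → ClassicalGapUniform 𝔟 ε m s ρ δ →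
        ∃ (kmax : ℝ → ℕ → ℕ) (C_s C₁ A₀ P₀ β₁ ℓ₁ D : ℝ) (p : Fin 4 × Fin 4 → ℝ → ℝ) (w : ℝ → ℕ → ℝ),
          0 < C_s ∧ 0 < C₁ ∧ 0 ≤ A₀ ∧ 0 < ℓ₁ ∧ (∀ q β, |p q β| ≤ P₀) ∧
          SplitCl 𝔟 ε kmax C_s C₁ A₀ β₁ ℓ₁ p ∧ (∀ β k, 0 ≤ w β k) ∧
          GuardedConditionalRaritySU2 𝔟 ε β₁ m s ρ w ∧
          (∀ β : ℝ, β₁ ≤ β → ∀ R : ℕ, ∑ k ∈ (Finset.range (kmax β R + 1)).filter (fun k => 1 ≤ k), w β k ≤ D) := by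
  sorry

/-- STUB (GD) «GAUSSIAN DOMINATION of the classical centre response» (XL; named Prop `ClassicalResponse.GaussianDominationSU2`, p548409; text of
v7c/v8c/v8d minus the idle `UV →`): constants `m₁ v₁ β₁ ℓ₁` with the extensive sub-Gaussian law in LINEAR local sources for `√(carrierCl rF 1 1 β R q x)` on
every odd torus and cyclically `2R+4`-separated family on the window.  Why it might fail: uniform sub-Gaussian concentration of a boundary-flux statistic
under the weakly coupled Wilson state, uniformly in the torus size, is a UV-stability statement of E0′ type with NO finite-dimensional special case
(LEAD g10 §2(iii)); degenerate Laplace asymptotics around the flat variety (torons, zero modes).  (Idea banked for a later generation, NOT this line: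
reflection positivity ∕ the FILS chessboard reduce the separated-family law to a PRESSURE bound for a periodic `√Q`-perturbation; the tree's
`…CeilingsBlockChessboard(Null)`, `…OddCycleChessboard*` are the engines; odd tori `2L+1` are the obstacle.) -/
theorem stub_gaussianDomination : GaussianDominationSU2 := by
  sorry

/-- GLUE (proved here, modus ponens): a block size past both thresholds (`2·max b₀ b₁ + 3`, odd), the small-field radius from the quantum stub, the data
from the classical stub, and the package of v8d (`DLRPeeling.BackgroundFieldGUCRSU2`) repacked in its own letters. -/
theorem backgroundFieldGUCRSU2_of_stubs
    (hA : ∃ b₀ : ℕ, ∀ 𝔟 : BlockSize, b₀ ≤ 𝔟.b → ∀ ε_t : ℝ, 0 < ε_t →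
      ∃ (ε : ℝ → ℕ → ℝ) (m s J k₀ : ℕ) (ρ ε₀ δ : ℝ),
        Admissible ε_t 𝔟 ε m s J k₀ ρ ε₀ ∧ 0 < δ ∧ ClassicalGapUniform 𝔟 ε m s ρ δ)
    (hB : ∃ b₁ : ℕ, ∀ 𝔟 : BlockSize, b₁ ≤ 𝔟.b → ∃ ε_t : ℝ, 0 < ε_t ∧
      ∀ (ε : ℝ → ℕ → ℝ) (m s J k₀ : ℕ) (ρ ε₀ δ : ℝ),
        Admissible ε_t 𝔟 ε m s J k₀ ρ ε₀ → 0 < δ → ClassicalGapUniform 𝔟 ε m s ρ δ →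
        ∃ (kmax : ℝ → ℕ → ℕ) (C_s C₁ A₀ P₀ β₁ ℓ₁ D : ℝ) (p : Fin 4 × Fin 4 → ℝ → ℝ) (w : ℝ → ℕ → ℝ),
          0 < C_s ∧ 0 < C₁ ∧ 0 ≤ A₀ ∧ 0 < ℓ₁ ∧ (∀ q β, |p q β| ≤ P₀) ∧
          SplitCl 𝔟 ε kmax C_s C₁ A₀ β₁ ℓ₁ p ∧ (∀ β k, 0 ≤ w β k) ∧
          GuardedConditionalRaritySU2 𝔟 ε β₁ m s ρ w ∧
          (∀ β : ℝ, β₁ ≤ β → ∀ R : ℕ, ∑ k ∈ (Finset.range (kmax β R + 1)).filter (fun k => 1 ≤ k), w β k ≤ D)) :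
    BackgroundFieldGUCRSU2 := by
  obtain ⟨b₀, hA⟩ := hA
  obtain ⟨b₁, hB⟩ := hB
  -- a common admissible block size: the odd number `2·max b₀ b₁ + 3`
  let 𝔟 : BlockSize := ⟨2 * max b₀ b₁ + 3, ⟨max b₀ b₁ + 1, by ring⟩, by omega⟩
  have h₀ : b₀ ≤ 𝔟.b := by
    show b₀ ≤ 2 * max b₀ b₁ + 3
    have := le_max_left b₀ b₁; omega
  have h₁ : b₁ ≤ 𝔟.b := by
    show b₁ ≤ 2 * max b₀ b₁ + 3
    have := le_max_right b₀ b₁; omega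
  obtain ⟨ε_t, hεt, hB⟩ := hB 𝔟 h₁
  obtain ⟨ε, m, s, J, k₀, ρ, ε₀, δ, hadm, hδ, hCG⟩ := hA 𝔟 h₀ ε_t hεt
  obtain ⟨kmax, C_s, C₁, A₀, P₀, β₁, ℓ₁, D, p, w, hCs, hC₁, hA₀, hℓ₁, hp, hsplit, hw0, hGUCR, hD⟩ :=
    hB ε m s J k₀ ρ ε₀ δ hadm hδ hCG
  obtain ⟨hε₀, hε, hJ, hρ, hρJ, hsched, hm, _⟩ := hadm
  exact ⟨𝔟, ε, kmax, C_s, C₁, A₀, P₀, β₁, ℓ₁, D, ε₀, p, m, s, J, ρ, w, hCs, hC₁, hA₀, hℓ₁, hp, hsplit, hε₀, hε, hJ, hρ, hρJ,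
    hsched, hm, hw0, hGUCR, hD⟩

/-- (RM) — a THEOREM of the skeleton: the registered v5(α) text of `stub_responseMomentsOdd6` VERBATIM (`UV →` kept because it is the registered text; the
hypothesis is not consumed), through `backgroundFieldGUCRSU2_of_stubs` and v8d's landed glue
`DLRPeeling.responseMomentsOdd6SU2_of_backgroundFieldGUCR_and_gaussianDomination` (p593010; `ResponseMomentsOdd6SU2` is the body by `Iff.rfl`). -/
theorem stub_responseMomentsOdd6 :
    Summit.QuantumFields.YangMills.Theses.BalabanLadder.UV →
      letI : MeasurableSpace (Matrix.specialUnitaryGroup (Fin 2) ℂ) := borel _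
      haveI : BorelSpace (Matrix.specialUnitaryGroup (Fin 2) ℂ) := ⟨rfl⟩
      ∃ (a : ℝ → ℝ) (c : ℝ) (C₁ B β₁ ℓ₁ P₀ : ℝ) (p : Fin 4 × Fin 4 → ℝ → ℝ), 0 < c ∧
      (∀ᶠ β in atTop, a β ≤ c * Transport.uRec β) ∧ 0 < ℓ₁ ∧ 0 < C₁ ∧ (∀ q β, |p q β| ≤ P₀) ∧
      ∀ β : ℝ, β₁ ≤ β → ∀ (L n : ℕ) (q : Fin n → Fin 4 × Fin 4) (x : Fin n → (Fin 4 → ℤ)) (R : ℕ),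
      (∀ i, (q i).1 < (q i).2) → 1 ≤ R → (R : ℝ) * a β ≤ ℓ₁ → 4 * R + 8 ≤ L →
      (∀ i j : Fin n, i ≠ j → ∃ k : Fin 4,
      (2 * (R : ℤ) + 4) ≤ |((((x i k - x j k : ℤ) : ZMod (2 * L + 1))).valMinAbs : ℤ)|) →
      ∀ T : Finset (Fin n),
      torusE (Matrix.specialUnitaryGroup (Fin 2) ℂ) (Literature.MathematicalPhysics.QuantumLattice.fundamentalLatticeRep 2) β L
      (fun U => Real.exp (∑ i ∈ T, (R : ℝ) ^ 4 / C₁ *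
      |kerE (Matrix.specialUnitaryGroup (Fin 2) ℂ) (Literature.MathematicalPhysics.QuantumLattice.fundamentalLatticeRep 2) β
      (fun k => x i k - (R + 1)) (2 * R + 3) U
      (plane (Matrix.specialUnitaryGroup (Fin 2) ℂ) (Literature.MathematicalPhysics.QuantumLattice.fundamentalLatticeRep 2) (q i) (x i)) -
      p (q i) β|)) ≤ Real.exp (B * T.card) :=
  fun _ => responseMomentsOdd6SU2_of_backgroundFieldGUCR_and_gaussianDomination
    (backgroundFieldGUCRSU2_of_stubs stub_classicalGapData stub_temperedPackageGivenGap) stub_gaussianDomination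

/-- E0′ ceilings — a THEOREM of the skeleton (as v5(α)): (RM) through the landed press-button `TemperedResponse.stubCeilings_of_responseMoments`
(p532738).  Statement = v4-F's `stub_ceilings` VERBATIM. -/
theorem stub_ceilings :
    Summit.QuantumFields.YangMills.Theses.BalabanLadder.UV →
      letI : MeasurableSpace (Matrix.specialUnitaryGroup (Fin 2) ℂ) := borel _
      haveI : BorelSpace (Matrix.specialUnitaryGroup (Fin 2) ℂ) := ⟨rfl⟩
      MomentBounds6 (Matrix.specialUnitaryGroup (Fin 2) ℂ) rF uRec :=
  fun hUV => Summit.QuantumFields.YangMills.Cruxes.UVSeamRec.TemperedResponse.stubCeilings_of_responseMoments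
    (stub_responseMomentsOdd6 hUV)

/-- STUB F-B∧F-C «compact-witness floors at an asymptotically-two-loop engine unit» (XL; NO `UV`; BYTE-IDENTICAL to v5(α)/v7c/v8c/v8d; = the engine
data of the landed per-representation transfer `UnitTransfer.lowerBounds_uRec_of_engine rF`, p441552): the FUNDAMENTAL representation `rF` of `SU(2)` and
a unit map `a` with `a β / uRec β → c₀ > 0` carrying the `Q2`/`Q3` floors with COMPACTLY SUPPORTED witnesses.  Supplier: the NT line's conditional femto
package at `SU(2)`-fundamental (19353 `stub_cfp : CFP` engine E1–E3; landed discharge `FloorsEngineOfWindow.floorsEngine_of_fcp_commensurable rF a …`,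
p448741).  NOT rescued by this line (its rescue is a line on 19353).  Why it might fail: as NT (19353) — a β-uniform floor is dimensional transmutation
(barrier PerturbativeInvisibility) — plus the scaling of the non-perturbative unit (Patrascioiu–Seiler vs. consensus). -/
theorem stub_floorsEngine :
    letI : MeasurableSpace (Matrix.specialUnitaryGroup (Fin 2) ℂ) := borel _
    haveI : BorelSpace (Matrix.specialUnitaryGroup (Fin 2) ℂ) := ⟨rfl⟩
    ∃ (a : ℝ → ℝ) (c₀ : ℝ), 0 < c₀ ∧ (∀ β, 0 < a β) ∧
      Tendsto (fun β => a β / uRec β) atTop (𝓝 c₀) ∧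
      (∃ (v : 𝓢(EuclideanSpace ℝ (Fin 4), ℝ)) (ε β₅ Λ₅ : ℝ),
        HasCompactSupport (v : EuclideanSpace ℝ (Fin 4) → ℝ) ∧
        tsupport (v : EuclideanSpace ℝ (Fin 4) → ℝ) ⊆ {y : EuclideanSpace ℝ (Fin 4) | 0 < y 0} ∧ 0 < ε ∧
        ∀ β : ℝ, β₅ ≤ β → ∀ L : ℕ, Λ₅ ≤ a β * L →
          ε ≤ Q2 (Matrix.specialUnitaryGroup (Fin 2) ℂ) rF β L (a β) (thetaTest 4 v) v) ∧
      (∃ (f g h : 𝓢(EuclideanSpace ℝ (Fin 4), ℝ)) (ε β₅ Λ₅ : ℝ),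
        HasCompactSupport (f : EuclideanSpace ℝ (Fin 4) → ℝ) ∧
        HasCompactSupport (g : EuclideanSpace ℝ (Fin 4) → ℝ) ∧
        HasCompactSupport (h : EuclideanSpace ℝ (Fin 4) → ℝ) ∧
        Disjoint (tsupport (f : EuclideanSpace ℝ (Fin 4) → ℝ)) (tsupport (g : EuclideanSpace ℝ (Fin 4) → ℝ)) ∧
        Disjoint (tsupport (g : EuclideanSpace ℝ (Fin 4) → ℝ)) (tsupport (h : EuclideanSpace ℝ (Fin 4) → ℝ)) ∧
        Disjoint (tsupport (f : EuclideanSpace ℝ (Fin 4) → ℝ)) (tsupport (h : EuclideanSpace ℝ (Fin 4) → ℝ)) ∧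
        0 < ε ∧ ∀ β : ℝ, β₅ ≤ β → ∀ L : ℕ, Λ₅ ≤ a β * L →
          ε ≤ |Q3 (Matrix.specialUnitaryGroup (Fin 2) ℂ) rF β L (a β) f g h|) := by
  sorry

/-- COMPOSITION (kernel-checked, closed form): ceilings ⊕ engine floors ⊕ LANDED unit transfer ⊕ transport ⇒ the item BY NAME. -/
theorem UVSeamRec_of : Summit.QuantumFields.YangMills.Theses.BalabanLadder.UVSeamRec := by
  intro hUV G _ _ _ _ hG hcl
  letI : MeasurableSpace (Matrix.specialUnitaryGroup (Fin 2) ℂ) := borel _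
  haveI : BorelSpace (Matrix.specialUnitaryGroup (Fin 2) ℂ) := ⟨rfl⟩
  have hc := stub_ceilings hUV
  obtain ⟨a, c₀, hc₀, ha, hau, h2, h3⟩ := stub_floorsEngine
  have hlb := Summit.QuantumFields.YangMills.Cruxes.UVSeamRec.UnitTransfer.lowerBounds_uRec_of_engine rF hc₀ ha hau hc h2 h3
  exact stub_transport ⟨rF, hlb, hc⟩ G hG hcl

end Summit.QuantumFields.YangMills.Cruxes.UVSeamRec.GuardedClassicalGap
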